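import Literature.Probability.RandomPlanarGeometry.SLETraceApproximation
import Literature.Probability.RandomPlanarGeometry.ContinuousPathProjectionC
import Literature.Probability.RandomPlanarGeometry.SLESixMoebiusLocality
import Mathlib.MeasureTheory.Measure.HasOuterApproxClosed
import HarnessLib

/-!
# The Loewner trace as a Borel functional of the driving path; stopped classes; weak limits

Topic `Probability/RandomPlanarGeometry`. Measure-theoretic glue for identities IN LAW between
curve classes of Loewner traces stopped at random times, when the two traces are driven by two
processes with the same path law living on different probability spaces (the situation of
Lawler's locality theorem for SLE₆, Lawler (2005), §6.3 Thm. 6.13 / Prop. 6.14, tree: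
`sle_six_moebius_locality`, where the image driving function `√6 B̃` of the Dambis–Dubins–Schwarz
time change lives on an enlarged product space):

* `traceOf : C(ℝ≥0, ℝ) → C(ℝ≥0, ℂ)` — a BOREL map with `traceOf W = γ` whenever the chordal
  Loewner chain of `W` is generated by the curve `γ` (`traceOf_eq`): the projection
  `(γ, W) ↦ W` of the closed set `generatedPairs` (`SLETraceApproximation`) is an injective Borel
  map of a standard Borel space, hence a measurable embedding (Lusin–Souslin, Mathlib
  `Measurable.measurableEmbedding`), and `(γ, W) ↦ γ` extends measurably along it
  (`MeasurableEmbedding.exists_measurable_extend`); the set of generated driving paths is Borel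
  (`measurableSet_snd_image_generatedPairs`);
* `stopClass γ τ` — the curve class of the continuous path `γ` stopped at time `τ`, jointly
  continuous in `(γ, τ)` (`continuous_stopClass`, from `continuous_mk_stopPath` of
  `ContinuousPathProjectionC`), equal to `stoppedPathClass id ⇑γ τ` and to `stoppedPathClass F γ₀ τ`
  for `γ = F ∘ γ₀` continuous (`stoppedPathClass_eq_stopClass`);
* `measure_setOf_mem_eq_of_tendsto_ae` — **identification of laws through almost sure limits**:
  if `Zₙ → Z` and `Zₙ' → Z'` almost surely in a metric Borel space and `Zₙ`, `Zₙ'` have the same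
  law for every `n`, then `Z` and `Z'` have the same law (bounded convergence for bounded
  continuous test functions and `ext_of_forall_lintegral_eq_of_IsFiniteMeasure`).

## References

* A. S. Kechris, *Classical Descriptive Set Theory* (1995), Thm. 15.1 (Lusin–Souslin).
  [Kechris1995]
* P. Billingsley, *Convergence of Probability Measures*, 2nd ed. (1999), Thm. 1.2, §7.
  [Billingsley1999]
* G. F. Lawler, *Conformally Invariant Processes in the Plane* (2005), §6.3. [Lawler2005]
-/

noncomputable section

open MeasureTheory Filter Set Function
open scoped NNReal ENNReal Topology unitInterval BoundedContinuousFunction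

namespace Literature.Probability.RandomPlanarGeometry

open scoped PathBorel

/-! ### The trace as a Borel functional of the driving path -/

section TraceOf

/-- The projection `(γ, W) ↦ W` restricted to the closed set of generated pairs. [folklore] -/
def generatedSnd : generatedPairs → C(ℝ≥0, ℝ) := fun p ↦ p.1.2

/-- The curve coordinate `(γ, W) ↦ γ` on generated pairs. [folklore] -/
def generatedFst : generatedPairs → C(ℝ≥0, ℂ) := fun p ↦ p.1.1

/-- The projection is measurable. [folklore] -/
theorem measurable_generatedSnd : Measurable generatedSnd :=
  measurable_snd.comp measurable_subtype_coe

/-- The curve coordinate is measurable. [folklore] -/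
theorem measurable_generatedFst : Measurable generatedFst :=
  measurable_fst.comp measurable_subtype_coe

/-- The projection is injective on generated pairs (uniqueness of the generating curve).
[cite: Lawler2005, §4.1] -/
theorem injective_generatedSnd : Injective generatedSnd := by
  intro p p' h
  exact Subtype.ext (injOn_snd_generatedPairs p.2 p'.2 h)

/-- **The projection of generated pairs to driving paths is a measurable embedding**
(Lusin–Souslin). [cite: Kechris1995, Thm. 15.1] -/
theorem measurableEmbedding_generatedSnd : MeasurableEmbedding generatedSnd := by
  classical
  letI := TopologicalSpace.upgradeIsCompletelyMetrizable C(ℝ≥0, ℂ)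
  letI := TopologicalSpace.upgradeIsCompletelyMetrizable C(ℝ≥0, ℝ)
  haveI : StandardBorelSpace generatedPairs := measurableSet_generatedPairs.standardBorel
  exact measurable_generatedSnd.measurableEmbedding injective_generatedSnd

/-- Existence of a Borel trace functional. [folklore] -/
theorem exists_traceOf : ∃ T : C(ℝ≥0, ℝ) → C(ℝ≥0, ℂ), Measurable T ∧ T ∘ generatedSnd = generatedFst :=
  measurableEmbedding_generatedSnd.exists_measurable_extend measurable_generatedFst
    fun _ ↦ ⟨(0 : C(ℝ≥0, ℂ))⟩

/-- **The Loewner trace as a Borel functional of the driving path**: a measurable map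
`C(ℝ≥0, ℝ) → C(ℝ≥0, ℂ)` which is the generating curve on every driving path whose chain is
generated by a curve (junk elsewhere). [folklore] -/
def traceOf : C(ℝ≥0, ℝ) → C(ℝ≥0, ℂ) := exists_traceOf.choose

/-- `traceOf` is Borel measurable. [folklore] -/
@[fun_prop]
theorem measurable_traceOf : Measurable traceOf := exists_traceOf.choose_spec.1

/-- **`traceOf W = γ` when the chain of `W` is generated by the continuous-map curve `γ`.**
[folklore] -/
theorem traceOf_eq_of_mem {γ : C(ℝ≥0, ℂ)} {W : C(ℝ≥0, ℝ)} (h : Loewner.IsGeneratedByCurve W γ) :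
    traceOf W = γ := by
  have := congrFun exists_traceOf.choose_spec.2 ⟨(γ, W), h⟩
  exact this

/-- `traceOf W` is the generating curve, for any generating curve `γ : ℝ≥0 → ℂ`. [folklore] -/
theorem coe_traceOf_eq {γ : ℝ≥0 → ℂ} {W : C(ℝ≥0, ℝ)} (h : Loewner.IsGeneratedByCurve W γ) :
    ⇑(traceOf W) = γ := by
  have hγc : Continuous γ := h.continuous
  have h' : Loewner.IsGeneratedByCurve W (⟨γ, hγc⟩ : C(ℝ≥0, ℂ)) := h
  rw [traceOf_eq_of_mem h']
  rfl

/-- On the canonical space: `traceOf (drivingPath κ ω) = sleTrace κ ω` whenever the SLE_κ chain of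
`ω` is generated by a curve. [folklore] -/
theorem coe_traceOf_drivingPath {κ : ℝ≥0} {ω : ℝ≥0 → ℝ}
    (h : ∃ γ, Loewner.IsGeneratedByCurve (sleDriving κ ω) γ) :
    ⇑(traceOf (drivingPath κ ω)) = sleTrace κ ω := by
  have hgen := Loewner.isGeneratedByCurve_trace h
  exact coe_traceOf_eq hgen

end TraceOf

/-! ### The class of a stopped continuous path -/

section StopClass

/-- **The curve class of a continuous path stopped at a time**: the class of
`s ↦ γ (τ s)`, `s ∈ [0, 1]`. [folklore] -/
def stopClass (γ : C(ℝ≥0, ℂ)) (τ : ℝ≥0) : CurveClass ℂ :=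
  CurveClass.mk (Curve.mk (⟨fun s : I ↦ γ (((τ : ℝ) * s).toNNReal), γ.continuous.comp
    (continuous_real_toNNReal.comp (continuous_const.mul continuous_subtype_val))⟩ : C(I, ℂ)))

/-- **`stopClass` is jointly continuous** in (path, time). [folklore] -/
theorem continuous_stopClass : Continuous fun q : C(ℝ≥0, ℂ) × ℝ≥0 ↦ stopClass q.1 q.2 :=
  continuous_mk_stopPath

/-- `stopClass` is jointly Borel measurable. [folklore] -/
theorem measurable_stopClass : Measurable fun q : C(ℝ≥0, ℂ) × ℝ≥0 ↦ stopClass q.1 q.2 :=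
  continuous_stopClass.measurable

/-- `stoppedPathClass id` of a continuous path is its `stopClass`. [folklore] -/
theorem stoppedPathClass_id_eq_stopClass (γ : C(ℝ≥0, ℂ)) (τ : ℝ≥0) :
    stoppedPathClass id (⇑γ) τ = stopClass γ τ := by
  rw [stoppedPathClass_eq (continuous_stoppedPath_id γ.continuous τ)]
  rfl

/-- **`stoppedPathClass F γ₀ τ = stopClass γ τ` when `F ∘ γ₀ = γ` is continuous** (e.g. `F` a
Möbius map and `γ₀` a path avoiding its pole). [folklore] -/
theorem stoppedPathClass_eq_stopClass {F : ℂ → ℂ} {γ₀ : ℝ≥0 → ℂ} (γ : C(ℝ≥0, ℂ))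
    (hγ : ∀ t, F (γ₀ t) = γ t) (τ : ℝ≥0) : stoppedPathClass F γ₀ τ = stopClass γ τ := by
  have hc : Continuous (fun s : I ↦ F (γ₀ (((τ : ℝ) * s).toNNReal))) := by
    simp only [hγ]
    exact γ.continuous.comp (continuous_real_toNNReal.comp (continuous_const.mul continuous_subtype_val))
  rw [stoppedPathClass_eq hc, stopClass]
  congr 3
  ext s
  exact hγ _

/-- A stopped class of a measurable random continuous path at a measurable random time is a
random variable. [folklore] -/
theorem Measurable.stopClass {Ω : Type*} [MeasurableSpace Ω] {Φ : Ω → C(ℝ≥0, ℂ)} {τ : Ω → ℝ≥0}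
    (hΦ : Measurable Φ) (hτ : Measurable τ) : Measurable fun ω ↦ stopClass (Φ ω) (τ ω) :=
  measurable_stopClass.comp (hΦ.prodMk hτ)

/-- A.e.-measurable version of `Measurable.stopClass`. [folklore] -/
theorem AEMeasurable.stopClass {Ω : Type*} [MeasurableSpace Ω] {P : Measure Ω} {Φ : Ω → C(ℝ≥0, ℂ)}
    {τ : Ω → ℝ≥0} (hΦ : AEMeasurable Φ P) (hτ : AEMeasurable τ P) :
    AEMeasurable (fun ω ↦ stopClass (Φ ω) (τ ω)) P :=
  measurable_stopClass.comp_aemeasurable (hΦ.prodMk hτ)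

/-- Stopped classes converge when the stopping times do (fixed continuous path). [folklore] -/
theorem tendsto_stopClass {γ : C(ℝ≥0, ℂ)} {τ : ℕ → ℝ≥0} {τ₀ : ℝ≥0} (h : Tendsto τ atTop (𝓝 τ₀)) :
    Tendsto (fun n ↦ stopClass γ (τ n)) atTop (𝓝 (stopClass γ τ₀)) := by
  have hc := (continuous_stopClass.tendsto (γ, τ₀)).comp
    ((tendsto_const_nhds (x := γ)).prodMk_nhds h)
  exact hc

end StopClass

/-! ### Identification of laws through almost sure limits -/

section WeakLimit

variable {Ω S : Type*} [MeasurableSpace Ω] {P : Measure Ω} [IsProbabilityMeasure P]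
  [MetricSpace S] [MeasurableSpace S] [BorelSpace S]

omit [IsProbabilityMeasure P] in
/-- Equal laws of two a.e.-measurable random variables give equal integrals of bounded continuous
nonnegative functions. [folklore] -/
theorem lintegral_comp_eq_of_law_eq {Z Z' : Ω → S} (hZ : AEMeasurable Z P) (hZ' : AEMeasurable Z' P)
    (hlaw : ∀ T : Set S, MeasurableSet T → P {ω | Z ω ∈ T} = P {ω | Z' ω ∈ T}) (f : S →ᵇ ℝ≥0) :
    ∫⁻ ω, f (Z ω) ∂P = ∫⁻ ω, f (Z' ω) ∂P := by
  have hmap : P.map Z = P.map Z' := by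
    refine Measure.ext fun T hT ↦ ?_
    rw [Measure.map_apply_of_aemeasurable hZ hT, Measure.map_apply_of_aemeasurable hZ' hT]
    exact hlaw T hT
  have hf : Measurable fun x : S ↦ (f x : ℝ≥0∞) := f.continuous.measurable.coe_nnreal_ennreal
  rw [← lintegral_map' hf.aemeasurable hZ, ← lintegral_map' hf.aemeasurable hZ', hmap]

/-- Bounded convergence for `∫⁻ f(Zₙ)` along an a.e. convergent sequence, `f` bounded continuous
nonnegative. [folklore] -/
theorem tendsto_lintegral_comp_of_tendsto_ae {Z : Ω → S} {Zn : ℕ → Ω → S}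
    (hZn : ∀ n, AEMeasurable (Zn n) P) (hlim : ∀ᵐ ω ∂P, Tendsto (fun n ↦ Zn n ω) atTop (𝓝 (Z ω)))
    (f : S →ᵇ ℝ≥0) :
    Tendsto (fun n ↦ ∫⁻ ω, f (Zn n ω) ∂P) atTop (𝓝 (∫⁻ ω, f (Z ω) ∂P)) := by
  have hf : Measurable fun x : S ↦ (f x : ℝ≥0∞) := f.continuous.measurable.coe_nnreal_ennreal
  refine tendsto_lintegral_of_dominated_convergence' (fun _ ↦ (nndist f 0 : ℝ≥0∞))
    (fun n ↦ hf.comp_aemeasurable (hZn n)) (fun n ↦ ae_of_all _ fun ω ↦ ?_) ?_ ?_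
  · exact ENNReal.coe_le_coe.2 (BoundedContinuousFunction.NNReal.upper_bound f (Zn n ω))
  · rw [lintegral_const, measure_univ, mul_one]
    exact ENNReal.coe_ne_top
  · filter_upwards [hlim] with ω hω
    exact (ENNReal.continuous_coe.tendsto _).comp ((f.continuous.tendsto _).comp hω)

/-- **Identification of laws through almost sure limits.** Let `Zₙ → Z` and `Zₙ' → Z'` almost
surely (metric Borel space), with `Zₙ`, `Zₙ'` a.e.-measurable and equal in law for every `n`. Then
`Z` and `Z'` are equal in law: `P{Z ∈ T} = P{Z' ∈ T}` for every Borel `T` (bounded convergence and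
`ext_of_forall_lintegral_eq_of_IsFiniteMeasure`). Billingsley (1999), Thm. 1.2 with the remark
that a.s. convergence implies weak convergence. [cite: Billingsley1999, Thm. 1.2] -/
theorem measure_setOf_mem_eq_of_tendsto_ae {Z Z' : Ω → S} {Zn Zn' : ℕ → Ω → S}
    (hZn : ∀ n, AEMeasurable (Zn n) P) (hZn' : ∀ n, AEMeasurable (Zn' n) P)
    (hlaw : ∀ n (T : Set S), MeasurableSet T → P {ω | Zn n ω ∈ T} = P {ω | Zn' n ω ∈ T})
    (hlim : ∀ᵐ ω ∂P, Tendsto (fun n ↦ Zn n ω) atTop (𝓝 (Z ω)))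
    (hlim' : ∀ᵐ ω ∂P, Tendsto (fun n ↦ Zn' n ω) atTop (𝓝 (Z' ω)))
    {T : Set S} (hT : MeasurableSet T) : P {ω | Z ω ∈ T} = P {ω | Z' ω ∈ T} := by
  have hZ : AEMeasurable Z P := aemeasurable_of_tendsto_metrizable_ae atTop hZn hlim
  have hZ' : AEMeasurable Z' P := aemeasurable_of_tendsto_metrizable_ae atTop hZn' hlim'
  haveI : IsFiniteMeasure (P.map Z) := Measure.isFiniteMeasure_map P Z
  have hmap : P.map Z = P.map Z' := by
    refine ext_of_forall_lintegral_eq_of_IsFiniteMeasure fun f ↦ ?_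
    have hf : Measurable fun x : S ↦ (f x : ℝ≥0∞) := f.continuous.measurable.coe_nnreal_ennreal
    rw [lintegral_map' hf.aemeasurable hZ, lintegral_map' hf.aemeasurable hZ']
    have h1 := tendsto_lintegral_comp_of_tendsto_ae hZn hlim f
    have h2 := tendsto_lintegral_comp_of_tendsto_ae hZn' hlim' f
    have heq : (fun n ↦ ∫⁻ ω, f (Zn n ω) ∂P) = fun n ↦ ∫⁻ ω, f (Zn' n ω) ∂P :=
      funext fun n ↦ lintegral_comp_eq_of_law_eq (hZn n) (hZn' n) (hlaw n) f
    rw [heq] at h1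
    exact tendsto_nhds_unique h1 h2
  have h1 := Measure.map_apply_of_aemeasurable hZ hT
  have h2 := Measure.map_apply_of_aemeasurable hZ' hT
  rw [hmap] at h1
  show P (Z ⁻¹' T) = P (Z' ⁻¹' T)
  rw [← h1, h2]

end WeakLimit

end Literature.Probability.RandomPlanarGeometry
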